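import Mathlib
import HarnessLib
import Literature.Combinatorics.Additive.KempermanStructureTheoremNecessity
import Literature.Combinatorics.Additive.NearlyQuasiPeriodicSummands

/-!
# Grynkiewicz 2009, Lemma 5.9: the two-component transfer lemma

[cite: Grynkiewicz2009, Lemma 5.9] [tag: critical-pair] [tag: inverse-theorem]

Topic `Literature/Combinatorics/Additive`.  Cell `mm-stpp` (D-0046), seat `mm-stpp-lit` (gen 23); the
port of D. J. Grynkiewicz, *A step beyond Kemperman's structure theorem*, Mathematika **55** (2009)
67–114 continued (`QuasiPeriodicDecompositions.lean` §2, `QuasiProgressions.lean` Lemma 5.8,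
`NearlyPeriodicSummands.lean` Lemma 5.6, `NearlyQuasiPeriodicSummands.lean` Lemma 5.7,
`KempermanStructureTheoremNecessity.lean` KST).  This file: **Lemma 5.9** (arXiv:0710.1041v2
Lemma 4.13), «one of our main tools for reducing the case `A + B = C` to a case `A' + B' = C'` …
[it] will allow us to conclude the sets `A' = A + {0, d}`, `B' = B` and `C' = C + {0, d}` also satisfy
`|A' + B'| = |A'| + |B'|` (whence induction will be employed), provided `c_d(A) = 2` for some nonzero
`d`» (print p. 20).

SOURCE (print p. 20 = p0020 of the held text `paper:doi-10-1112-s0025579300000966`; proof p. 21;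
arXiv v2 pp. 18–19, read 2026-08-29).  «**Lemma 5.9.** Let `A` and `B` be nonempty subsets of a
finite abelian group `G` with `|A + B| = |A| + |B|`, `0 ∈ A ∩ B`, `|A| ≥ 4`, `|B| ≥ 3`,
`d⊆(A + B, 𝒫) ≥ 3`, `(A, B)` non-extendible, `⟨A⟩ = G` and `A` not quasi-periodic.  If `c_d(A) = 2`
for some nonzero `d`, then either `c_d(B), c_d(A + B) ≤ 2`, or else (17) holds and either
`d⊆(C, 𝒬𝒫) = 1`, for all `C ∈ {A, B, A + B, Ā, B̄, \overline{A + B}}`, or `d⊆(B, 𝒜𝒫) = 0`.»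
Here (17) is «`|(A ∪ {α}) + (B ∪ {β})| = |A ∪ {α}| + |B ∪ {β}| − 1` for some `α, β`», `c_d` is
`componentCount`, `d⊆` is `subsetDist`, `𝒬𝒫` the quasi-periodic sets (`IsQuasiPeriodic`), `𝒜𝒫` the
arithmetic progressions (`IsAP` of `Vosper.lean`, with some non-zero difference, §2), `𝒫` the periodic sets; as in the
ports of Lemmas 5.6/5.7 the hypothesis `d⊆(A + B, 𝒫) ≥ 3` is carried unfolded («every periodic superset
of `A + B` has at least three more elements») and «`(A, B)` non-extendible» as the two one-sided
statements `IsNonExtendible A B`, `IsNonExtendible B A`.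

MAIN RESULTS (0 definitions, 0 named facts; everything PROVED).
* `Grynkiewicz2009.componentCount_le_two_or_seventeen_of_componentCount_eq_two` — **Lemma 5.9**.
* `isElementaryPair_of_not_isQuasiPeriodic_right` — the use of KST in the proof: a critical pair
  `(X, Y)` with aperiodic sum, `Y` not quasi-periodic and the differences of `Y` generating `G`, is
  elementary («Hence `H = G`»).
* `exists_isAP_of_isElementaryPair` — «we cannot have type (I), nor as the sumset is aperiodic can we
  have type (III) … and thus must have type (IV). Hence … `|Ā + {0, d}| = |G| − 1`»: such a pair with
  `|X|, |Y| ≥ 2` and `|X + Y| ≤ |G| − 2` is of type (II), i.e. two progressions of a common difference.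
* `Grynkiewicz2009.critical_add_pair_of_componentCount` — display (37) with Kneser: `c_d(U + Y) = 2`,
  `|U + Y| = |U| + |Y|`, `c_d(U) ≥ 3`, `U + Y + {0, d}` aperiodic ⟹ `(U + {0, d}, Y)` is a critical pair
  and `c_d(U) = 3`.
* `Grynkiewicz2009.seventeen_of_isPeriodic_compl_add_pair` — «If `Ā + {0, d}` is periodic, then
  `|A| ≥ 3` and `c_d(Ā) = 2` imply that `A` is a union of a nonempty periodic set and at most two
  elements, whence Lemma 5.6 …».

PROOF, as printed (p. 21), with the tree's tools: Proposition 2.4 (`isNonExtendible_pair_neg_compl'`,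
`isNonExtendible_pair_neg_compl`), `c_d(Ā) = c_d(A)` (`componentCount_compl`), Kneser
(`add_kneser`), KST (`exists_isKempermanDecompI`), Lemma 5.4 rolled out (`not_isQuasiPeriodic_six`,
`not_isQuasiPeriodic_add_and_compl`), Lemma 5.8 (`Grynkiewicz2009.subsetDist_quasiProgression_of_isAP`
and its complement clause), Lemma 5.6 (`Grynkiewicz2009.seventeen_of_nearly_periodic`,
`Grynkiewicz2009.subsetDist_eq_one_of_nearly_periodic`; the print routes the periodic case through
«Lemma 5.6 implies `d⊆(A, 𝒬𝒫) = 1`. Thus Lemma 5.7 completes the proof» — Lemma 5.6's own second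
conclusion already is the statement for all six sets, so Lemma 5.7 is not called).  The argument
«with the roles of `B` and `\overline{A + B}` interchanged» is the second call of the same two lemmas,
on the pair `(−\overline{A + B} + {0, d}, B)` whose sum is `−Ā + {0, d} = −(−d + (Ā + {0, d}))`.

## References
* D. J. Grynkiewicz, *A step beyond Kemperman's structure theorem*, Mathematika 55 (2009) 67–114,
  doi:10.1112/S0025579300000966, Lemma 5.9 (p. 20, proof p. 21); arXiv:0710.1041v2 Lemma 4.13
  [cite: Grynkiewicz2009, Lemma 5.9] — held `paper:doi-10-1112-s0025579300000966` /
  `paper:arxiv-0710.1041`.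
* J. H. B. Kemperman, *On small sumsets in an abelian group*, Acta Math. 103 (1960) 63–88, Thm 5.1
  [cite: Kemperman1960, Thm 5.1].
-/

namespace Literature.Combinatorics.Additive

open Finset
open scoped Pointwise

universe u

section KSTCorollaries

variable {G : Type u} [AddCommGroup G] [Fintype G] [DecidableEq G]

omit [Fintype G] in
/-- A subgroup containing all differences of a set `Y` one of whose translates `−γ + Y` (`γ ∈ Y`)
generates `G` is all of `G` («since `⟨−γ + \overline{A + B}⟩ = G` … it follows that» the quasi-period
is `G`). [cite: Grynkiewicz2009, Lemma 5.9 (proof)] -/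
theorem eq_top_of_forall_sub_mem {Y : Finset G} {γ : G} (hγ : γ ∈ Y)
    (hgen : AddSubgroup.closure (((-γ) +ᵥ Y : Finset G) : Set G) = ⊤) (H : AddSubgroup G)
    (hH : ∀ x ∈ Y, ∀ y ∈ Y, x - y ∈ H) : H = ⊤ := by
  rw [← top_le_iff, ← hgen, AddSubgroup.closure_le]
  intro z hz
  rw [mem_coe, mem_vadd_finset] at hz
  obtain ⟨y, hy, rfl⟩ := hz
  rw [vadd_eq_add, neg_add_eq_sub]
  exact hH y hy γ hγ

/-- **The use of KST in Lemma 5.9** («whence we can apply KST to the pair … In view of Lemma 5.4, it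
follows that `\overline{A + B}` is not quasi-periodic and that `⟨γ − \overline{A + B}⟩ = G` … Hence
`H = G`»): in a finite nontrivial abelian group, a critical pair `(X, Y)` (`|X + Y| = |X| + |Y| − 1`)
with `X + Y` aperiodic, `Y` not quasi-periodic, and every subgroup containing the differences of `Y`
equal to `G`, is an elementary pair — in a Kemperman decomposition (`exists_isKempermanDecompI`) the
periodic part of `Y` is empty, so `Y` lies in one coset of the quasi-period `H`, forcing `H = G`, and
then the periodic part of `X` (disjoint from the nonempty aperiodic part) is empty too.
[cite: Grynkiewicz2009, Lemma 5.9 (proof)] [cite: Kemperman1960, Thm 5.1] -/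
theorem isElementaryPair_of_not_isQuasiPeriodic_right [Nontrivial G] {X Y : Finset G}
    (hX : X.Nonempty) (hY : Y.Nonempty) (hcrit : #(X + Y) + 1 = #X + #Y)
    (hap : ¬ IsPeriodic (X + Y)) (hYqp : ¬ IsQuasiPeriodic Y)
    (hYgen : ∀ H : AddSubgroup G, (∀ x ∈ Y, ∀ y ∈ Y, x - y ∈ H) → H = ⊤) :
    IsElementaryPair X Y := by
  obtain ⟨H, X₁, X₀, Y₁, Y₀, hd⟩ := exists_isKempermanDecompI hX hY hcrit (Or.inl hap)
  obtain ⟨-, hY₀⟩ := hd.decomp_right.left_eq_empty_of_not_isQuasiPeriodic hYqp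
  have hH : H = ⊤ := hYgen H (by rw [← hY₀]; exact hd.decomp_right.sub_mem)
  have hX₁ : X₁ = ∅ := by
    by_contra hne
    obtain ⟨x₁, hx₁⟩ := nonempty_iff_ne_empty.2 hne
    obtain ⟨x₀, hx₀⟩ := hd.left_nonempty
    have h1 : (x₀ - x₁) +ᵥ X₁ = X₁ :=
      hd.decomp_left.periodic _ (by rw [hH]; exact AddSubgroup.mem_top _)
    have : x₀ ∈ X₁ := by
      rw [← h1]
      exact mem_vadd_finset.2 ⟨x₁, hx₁, by rw [vadd_eq_add, sub_add_cancel]⟩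
    exact disjoint_left.1 hd.decomp_left.disjoint this hx₀
  have hX₀ : X₀ = X := by
    have := hd.decomp_left.union_eq
    rwa [hX₁, empty_union] at this
  rw [← hX₀, ← hY₀]
  exact hd.elementary

/-- **The type analysis in Lemma 5.9** («Hence `H = G`, whence we cannot have type (I), nor as the
sumset is aperiodic can we have type (III). Suppose we have type (II). Hence `\overline{A + B}` is an
arithmetic progression with difference `d'` … So we cannot have type (II), and thus must have type
(IV). Hence, since `⟨−γ + \overline{A + B}⟩ = G` …, it follows that `|Ā + {0, d}| = |G| − 1`»): an
elementary pair `(X, Y)` with `|X|, |Y| ≥ 2`, aperiodic sum, every subgroup containing the differences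
of `Y` equal to `G`, and `|X + Y| ≤ |G| − 2`, is of type (II): `X` and `Y` are arithmetic
progressions with a common difference.  (Type (I) needs a singleton; type (III) has the periodic sum
`a + b + H`, `|H| = |X| + |Y| − 1 ≥ 3`; type (IV) has `H = G` and then `|X + Y| = |H| − 1 = |G| − 1`,
`IsElementaryIV.card_add_of_data`.) [cite: Grynkiewicz2009, Lemma 5.9 (proof)] -/
theorem exists_isAP_of_isElementaryPair {X Y : Finset G} (hel : IsElementaryPair X Y)
    (hX2 : 2 ≤ #X) (hY2 : 2 ≤ #Y) (hap : ¬ IsPeriodic (X + Y))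
    (hYgen : ∀ H : AddSubgroup G, (∀ x ∈ Y, ∀ y ∈ Y, x - y ∈ H) → H = ⊤)
    (hcard : #(X + Y) + 2 ≤ Fintype.card G) : ∃ d', IsAP X d' ∧ IsAP Y d' := by
  rcases hel with hI | hII | hIII | hIV
  · rcases hI.2.2 with h | h <;> omega
  · obtain ⟨-, -, d', hXd, hYd, -⟩ := hII
    exact ⟨d', hXd, hYd⟩
  · exfalso
    obtain ⟨H, a, b, -, -, hA, hB, hcardH, -⟩ := hIII
    obtain ⟨Hf, hHf, hHfc⟩ := exists_finset_carrier (Set.toFinite (H : Set G))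
    have heq := IsElementaryIII.add_eq_of_data hHf hHfc hA hB hcardH
    refine hap ⟨H, fun hbot => ?_, heq ▸ isPeriodicWith_vadd_carrier hHf _⟩
    rw [hbot, AddSubgroup.card_bot] at hcardH
    omega
  · exfalso
    obtain ⟨H, a, b, g, ha, -, hA, hB, -, -, hBap, hAg⟩ := hIV
    have hH : H = ⊤ := hYgen H fun x hx y hy => by
      have := H.sub_mem (hB x hx) (hB y hy)
      rwa [sub_sub_sub_cancel_right] at this
    have hHf : ∀ x, x ∈ (univ : Finset G) ↔ x ∈ H := fun x => by
      rw [hH]; exact iff_of_true (mem_univ _) (AddSubgroup.mem_top _)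
    obtain ⟨h1, -⟩ := IsElementaryIV.card_add_of_data hHf ha hA hB hBap hAg
    rw [card_univ] at h1
    omega

end KSTCorollaries

namespace Grynkiewicz2009

variable {G : Type u} [AddCommGroup G] [DecidableEq G]

/-- **Display (37) and the Kneser step of Lemma 5.9.**  If `|U + Y| = |U| + |Y|`, `c_d(U + Y) = 2`,
`c_d(U) ≥ 3` and `U + Y + {0, d}` is not periodic, then the pair `(U + {0, d}, Y)` — whose sum is
`U + Y + {0, d}`, of size `|U + Y| + 2` — is critical, `|(U + {0, d}) + Y| = |U + {0, d}| + |Y| − 1`,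
and `c_d(U) = 3` («since otherwise `|Ā| + 2 = |{0, d} + Ā| = |−B + {0, d} + \overline{A + B}| ≥
|−B + {0, d}| + |\overline{A + B}| ≥ |B| + 3 + |\overline{A + B}| = |G| − |A| + 3`, which is not
possible … Hence Kneser's Theorem and (37) imply `c_d(B) = 3` and» equality; in the print
`U = −B`, `Y = \overline{A + B}`, `U + Y = Ā`). [cite: Grynkiewicz2009, Lemma 5.9 (proof, (37))] -/
theorem critical_add_pair_of_componentCount {U Y : Finset G} {d : G} (hU : U.Nonempty)
    (hY : Y.Nonempty) (hUY : #(U + Y) = #U + #Y) (hc2 : componentCount d (U + Y) = 2)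
    (hc3 : 3 ≤ componentCount d U) (hnp : ¬ IsPeriodic (U + Y + {0, d})) :
    U + {0, d} + Y = U + Y + {0, d} ∧ #(U + {0, d} + Y) + 1 = #(U + {0, d}) + #Y ∧
      #(U + {0, d} + Y) = #(U + Y) + 2 ∧ componentCount d U = 3 := by
  have hcomm : U + {0, d} + Y = U + Y + {0, d} := add_right_comm _ _ _
  have hS : #(U + Y + {0, d}) = #(U + Y) + 2 := by rw [card_add_pair_zero, hc2]
  have hX : #(U + {0, d}) = #U + componentCount d U := card_add_pair_zero d U
  have hXne : (U + {0, d}).Nonempty := hU.add ⟨0, mem_insert_self _ _⟩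
  have hSne : (U + {0, d} + Y).Nonempty := hXne.add hY
  have hstab : (U + {0, d} + Y).addStab = {0} := by
    by_contra h
    exact hnp (hcomm ▸ (isPeriodic_iff_addStab_ne hSne).2 h)
  -- Kneser for an aperiodic sum: `|X| + |Y| ≤ |X + Y| + 1`
  have hkn := add_kneser (U + {0, d}) Y
  rw [hstab, Finset.singleton_zero, add_zero, add_zero, Finset.card_zero] at hkn
  rw [hcomm] at hkn ⊢
  refine ⟨rfl, ?_, hS, ?_⟩ <;> omega


/-- `−S + {0, d} = −(−d + (S + {0, d}))`: the «roles interchanged» sum of Lemma 5.9 is a reflected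
translate of the first one, so one is periodic iff the other is.
[cite: Grynkiewicz2009, Lemma 5.9 (proof, «Applying the above argument with the roles of B and
\overline{A+B} interchanged»)] -/
theorem neg_add_pair_zero_eq (S : Finset G) (d : G) :
    -S + {0, d} = -((-d) +ᵥ (S + {0, d})) := by
  rw [← neg_inj, neg_neg, neg_add, neg_neg]
  have h1 : -({0, d} : Finset G) = (-d) +ᵥ ({0, d} : Finset G) := by
    ext x
    simp only [mem_neg', mem_insert, mem_singleton, mem_vadd_finset, vadd_eq_add]
    constructor
    · rintro (h | h)
      · refine ⟨d, Or.inr rfl, ?_⟩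
        rw [neg_eq_zero] at h
        rw [h, neg_add_cancel]
      · refine ⟨0, Or.inl rfl, ?_⟩
        rw [add_zero, ← h, neg_neg]
    · rintro ⟨y, hy, rfl⟩
      rcases hy with rfl | rfl
      · right
        rw [add_zero, neg_neg]
      · left
        rw [neg_add_cancel, neg_zero]
  rw [h1, add_comm S, vadd_add_assoc, add_comm]

/-- Periodicity of `−S + {0, d}` is that of `S + {0, d}`. [cite: Grynkiewicz2009, Lemma 5.9 (proof)] -/
theorem isPeriodic_neg_add_pair_zero_iff (S : Finset G) (d : G) :
    IsPeriodic (-S + {0, d}) ↔ IsPeriodic (S + {0, d}) := by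
  rw [neg_add_pair_zero_eq, isPeriodic_neg_iff, isPeriodic_vadd_iff]

/-- **Lemma 5.9, the periodic case** («If `Ā + {0, d}` is periodic, then `|A| ≥ 3` and `c_d(Ā) = 2`
imply that `A` is a union of a nonempty periodic set and at most two elements, whence Lemma 5.6
implies `d⊆(A, 𝒬𝒫) = 1`. Thus Lemma 5.7 completes the proof»): under the standing hypotheses of
Lemma 5.9, if `Ā + {0, d}` is periodic then (17) holds and `d⊆(C, 𝒬𝒫) = 1` for all six sets `C`.
The nonempty periodic set is `A' = G ∖ (Ā + {0, d}) = A ∩ (d + A)`, of size `|A| − 2 ≥ 2`, with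
maximal period `H(A')`; the two remaining elements of `A` are the sets `A₁`, `A₂` of Lemma 5.6, whose
two conclusions (`seventeen_of_nearly_periodic`, `subsetDist_eq_one_of_nearly_periodic`) are the
claim. [cite: Grynkiewicz2009, Lemma 5.9 (proof)] -/
theorem seventeen_of_isPeriodic_compl_add_pair [Fintype G] {A B : Finset G} {d : G}
    (hA4 : 4 ≤ #A) (hB3 : 3 ≤ #B) (h0A : (0 : G) ∈ A) (h0B : (0 : G) ∈ B)
    (hAB : #(A + B) = #A + #B)
    (hP3 : ∀ P : Finset G, A + B ⊆ P → P.addStab ≠ {0} → 3 ≤ #(P \ (A + B)))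
    (hneA : IsNonExtendible A B) (hneB : IsNonExtendible B A)
    (hgen : AddSubgroup.closure (A : Set G) = ⊤) (hAqp : ¬ IsQuasiPeriodic A)
    (hcA : componentCount d A = 2) (hper : IsPeriodic (Aᶜ + {0, d})) :
    (∃ α β : G, #(insert α A + insert β B) + 1 = #(insert α A) + #(insert β B)) ∧
      ∀ C ∈ ({A, B, A + B, Aᶜ, Bᶜ, (A + B)ᶜ} : Finset (Finset G)),
        subsetDist C {P | IsQuasiPeriodic P} = 1 := by
  classical
  obtain ⟨K, hK, hKper⟩ := hper
  -- the nonempty periodic part `A' = (Ā + {0,d})ᶜ ⊆ A`, `|A'| = |A| − 2`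
  set A' : Finset G := (Aᶜ + {0, d})ᶜ with hA'def
  have hA'per : IsPeriodicWith K A' := hKper.compl
  have hcardS : #(Aᶜ + {0, d}) = #Aᶜ + 2 := by rw [card_add_pair_zero, componentCount_compl, hcA]
  have hA'sub : A' ⊆ A := by
    intro x hx
    rw [hA'def, mem_compl, add_pair_zero_eq_union, mem_union, not_or, mem_compl, not_not] at hx
    exact hx.1
  have hA'card : #A' + 2 = #A := by
    have h1 : #A' = Fintype.card G - #(Aᶜ + {0, d}) := by rw [hA'def]; exact card_compl _
    have h2 : #Aᶜ = Fintype.card G - #A := card_compl _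
    have h3 : #(Aᶜ + {0, d}) ≤ Fintype.card G := card_le_univ _
    have h4 : #A ≤ Fintype.card G := card_le_univ _
    omega
  have hA'ne : A'.Nonempty := card_pos.1 (by omega)
  -- the two remaining elements
  obtain ⟨a₁, a₂, hne12, h12⟩ : ∃ a₁ a₂, a₁ ≠ a₂ ∧ A \ A' = {a₁, a₂} :=
    card_eq_two.1 (by rw [card_sdiff_of_subset hA'sub]; omega)
  have hAdec : A = A' ∪ {a₁} ∪ {a₂} := by
    rw [union_assoc, ← insert_eq, ← h12, union_sdiff_of_subset hA'sub]
  -- the maximal period `H = H(A')` of `A'`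
  let H : AddSubgroup G := AddAction.stabilizer G A'
  have hA'H : ∀ g, g ∈ A'.addStab ↔ g ∈ H := fun g => by
    rw [mem_addStab hA'ne]; exact AddAction.mem_stabilizer_iff.symm
  have hKH : K ≤ H := fun k hk => AddAction.mem_stabilizer_iff.2 (hA'per k hk)
  have hH : H ≠ ⊥ := fun hbot => hK (le_bot_iff.1 (hbot ▸ hKH))
  have hA₁ : ∀ x ∈ ({a₁} : Finset G), x - a₁ ∈ H := fun x hx => by
    rw [mem_singleton] at hx; rw [hx, sub_self]; exact H.zero_mem
  have hA₂ : ∀ x ∈ ({a₂} : Finset G), x - a₂ ∈ H := fun x hx => by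
    rw [mem_singleton] at hx; rw [hx, sub_self]; exact H.zero_mem
  have hA3 : 3 ≤ #A := by omega
  refine ⟨seventeen_of_nearly_periodic hAdec hA'ne hH hA'H hA₁ hA₂ hA3 hB3 h0A h0B hAB hP3 hneA hneB
      hgen hAqp, fun C hC => ?_⟩
  exact (subsetDist_eq_one_of_nearly_periodic hAdec hA'ne hH hA'H hA₁ hA₂ hA3 hB3 h0A h0B hAB hP3
    hneA hneB hgen hAqp C hC).2

/-- **Grynkiewicz 2009, Lemma 5.9** (arXiv:0710.1041v2 Lemma 4.13; the «two-component transfer»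
lemma).  «Let `A` and `B` be nonempty subsets of a finite abelian group `G` with `|A + B| = |A| + |B|`,
`0 ∈ A ∩ B`, `|A| ≥ 4`, `|B| ≥ 3`, `d⊆(A + B, 𝒫) ≥ 3`, `(A, B)` non-extendible, `⟨A⟩ = G` and `A` not
quasi-periodic.  If `c_d(A) = 2` for some nonzero `d`, then either `c_d(B), c_d(A + B) ≤ 2`, or else
(17) holds and either `d⊆(C, 𝒬𝒫) = 1`, for all `C ∈ {A, B, A + B, Ā, B̄, \overline{A + B}}`, or
`d⊆(B, 𝒜𝒫) = 0`.»  Conventions: (17) = «`|(A ∪ {α}) + (B ∪ {β})| = |A ∪ {α}| + |B ∪ {β}| − 1` for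
some `α, β`» (with `+ 1` on the left, in `ℕ`); `d⊆(A + B, 𝒫) ≥ 3` unfolded as in Lemmas 5.6/5.7;
`𝒜𝒫 = {P | ∃ e ≠ 0, IsAP P e}` («an arithmetic progression with difference `d ∈ G ∖ 0`», §2).  PROOF as printed (p. 21), see the module docstring: if `Ā + {0, d}` is
periodic, `seventeen_of_isPeriodic_compl_add_pair`; otherwise `c_d(B) ≥ 3` is impossible
(`critical_add_pair_of_componentCount` on `(−B, \overline{A + B})`, KST via
`isElementaryPair_of_not_isQuasiPeriodic_right`, types sorted by `exists_isAP_of_isElementaryPair`,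
type (II) refuted by two applications of Lemma 5.8), and the same argument «with the roles of `B` and
`\overline{A + B}` interchanged» gives `c_d(A + B) ≤ 2` or `B` an arithmetic progression, in which
case Lemma 5.8 yields (17). [cite: Grynkiewicz2009, Lemma 5.9] -/
theorem componentCount_le_two_or_seventeen_of_componentCount_eq_two [Fintype G] {A B : Finset G}
    {d : G} (hA4 : 4 ≤ #A) (hB3 : 3 ≤ #B) (h0A : (0 : G) ∈ A) (h0B : (0 : G) ∈ B)
    (hAB : #(A + B) = #A + #B)
    (hP3 : ∀ P : Finset G, A + B ⊆ P → P.addStab ≠ {0} → 3 ≤ #(P \ (A + B)))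
    (hneA : IsNonExtendible A B) (hneB : IsNonExtendible B A)
    (hgen : AddSubgroup.closure (A : Set G) = ⊤) (hAqp : ¬ IsQuasiPeriodic A)
    (hd : d ≠ 0) (hcA : componentCount d A = 2) :
    (componentCount d B ≤ 2 ∧ componentCount d (A + B) ≤ 2) ∨
      ((∃ α β : G, #(insert α A + insert β B) + 1 = #(insert α A) + #(insert β B)) ∧
        ((∀ C ∈ ({A, B, A + B, Aᶜ, Bᶜ, (A + B)ᶜ} : Finset (Finset G)),
            subsetDist C {P | IsQuasiPeriodic P} = 1) ∨
          subsetDist B {P : Finset G | ∃ e : G, e ≠ 0 ∧ IsAP P e} = 0)) := by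
  classical
  haveI : Nontrivial G := nontrivial_of_ne d 0 hd
  have hAne : A.Nonempty := ⟨0, h0A⟩
  have hBne : B.Nonempty := ⟨0, h0B⟩
  -- `A + B` is aperiodic and `|\overline{A + B}| ≥ 3`
  have haper : (A + B).addStab = {0} := by
    by_contra hne
    have := hP3 (A + B) Subset.rfl hne
    rw [Finset.sdiff_self, card_empty] at this
    omega
  have hC3 : 3 ≤ #(A + B)ᶜ := by
    have hst : (univ : Finset G).addStab ≠ {0} := by
      intro heq
      have : d ∈ (univ : Finset G).addStab := (mem_addStab univ_nonempty).2 vadd_finset_univ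
      rw [heq, mem_singleton] at this
      exact hd this
    have := hP3 univ (subset_univ _) hst
    rwa [← compl_eq_univ_sdiff] at this
  have hCne : (A + B)ᶜ.Nonempty := card_pos.1 (by omega)
  -- cardinalities
  have hcardC : #(A + B)ᶜ + #A + #B = Fintype.card G := by
    have := card_le_univ (A + B); rw [card_compl]; omega
  have hcardAc : #Aᶜ + #A = Fintype.card G := by
    have := card_le_univ A; rw [card_compl]; omega
  have hcardBc : #Bᶜ + #B = Fintype.card G := by
    have := card_le_univ B; rw [card_compl]; omega
  have hAcne : Aᶜ.Nonempty := card_pos.1 (by omega)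
  have hBcne : Bᶜ.Nonempty := card_pos.1 (by omega)
  -- `A`, `B`, `Ā`, `B̄` are aperiodic
  have hAstab : A.addStab = {0} := by
    apply Subset.antisymm
    · rw [← haper]; exact subset_addStab_add_left hBne
    · rw [singleton_subset_iff]; exact hAne.zero_mem_addStab
  have hBstab : B.addStab = {0} := by
    apply Subset.antisymm
    · rw [← haper]; exact subset_addStab_add_right hAne
    · rw [singleton_subset_iff]; exact hBne.zero_mem_addStab
  have hAcstab : Aᶜ.addStab = {0} := by rw [addStab_compl hAne hAcne, hAstab]
  have hBcstab : Bᶜ.addStab = {0} := by rw [addStab_compl hBne hBcne, hBstab]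
  -- Proposition 2.4 and Lemma 5.4
  obtain ⟨h5, -, -⟩ := isNonExtendible_pair_neg_compl hneA hneB
  obtain ⟨h4, -, -⟩ := isNonExtendible_pair_neg_compl' hneA hneB
  obtain ⟨hBqp, -, -, -, hABcqp, hgenB⟩ :=
    not_isQuasiPeriodic_six (by omega) hB3 hC3 h0A h0B hAB haper hneA hneB hgen hAqp
  obtain ⟨-, -, hgenC⟩ :=
    not_isQuasiPeriodic_add_and_compl (by omega) hC3 h0A h0B hAB haper hneA hneB hgen hAqp
  have hYgenC : ∀ H : AddSubgroup G, (∀ x ∈ (A + B)ᶜ, ∀ y ∈ (A + B)ᶜ, x - y ∈ H) → H = ⊤ := by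
    obtain ⟨γ, hγ⟩ := hCne
    exact eq_top_of_forall_sub_mem hγ (hgenC γ hγ)
  have hYgenB : ∀ H : AddSubgroup G, (∀ x ∈ B, ∀ y ∈ B, x - y ∈ H) → H = ⊤ :=
    eq_top_of_forall_sub_mem h0B (by rwa [neg_zero, zero_vadd])
  -- the periodic case
  by_cases hper : IsPeriodic (Aᶜ + {0, d})
  · exact Or.inr ⟨(seventeen_of_isPeriodic_compl_add_pair hA4 hB3 h0A h0B hAB hP3 hneA hneB hgen
      hAqp hcA hper).1, Or.inl (seventeen_of_isPeriodic_compl_add_pair hA4 hB3 h0A h0B hAB hP3 hneA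
      hneB hgen hAqp hcA hper).2⟩
  -- FIRST: `c_d(B) ≤ 2`
  have hcB : componentCount d B ≤ 2 := by
    by_contra hcB3
    push Not at hcB3
    -- (37) and Kneser for `(−B + {0,d}, \overline{A+B})`, sum `Ā + {0,d}`
    have hUY : #(-B + (A + B)ᶜ) = #(-B) + #(A + B)ᶜ := by rw [h4, card_neg]; omega
    have hc2 : componentCount d (-B + (A + B)ᶜ) = 2 := by rw [h4, componentCount_compl, hcA]
    have hc3 : 3 ≤ componentCount d (-B) := by rw [componentCount_neg]; omega
    have hnp : ¬ IsPeriodic (-B + (A + B)ᶜ + {0, d}) := by rwa [h4]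
    obtain ⟨hcomm, hcrit, hS, -⟩ :=
      critical_add_pair_of_componentCount hBne.neg hCne hUY hc2 hc3 hnp
    have hXcard : #(-B + {0, d}) = #B + componentCount d B := by
      rw [card_add_pair_zero, componentCount_neg, card_neg]
    have hel := isElementaryPair_of_not_isQuasiPeriodic_right (hBne.neg.add ⟨0, mem_insert_self _ _⟩)
      hCne hcrit (by rwa [hcomm]) hABcqp hYgenC
    obtain ⟨d', hXd', hYd'⟩ := exists_isAP_of_isElementaryPair hel (by omega) (by omega)
      (by rwa [hcomm]) hYgenC (by rw [hS, h4]; omega)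
    -- Lemma 5.8 for `(\overline{A+B}, −B)`, sum `Ā`: `A ∈ QAP_{d'}`
    have hsum1 : (A + B)ᶜ + -B = Aᶜ := by rw [add_comm, h4]
    have h58a := subsetDist_quasiProgression_compl_of_isAP (A := (A + B)ᶜ) (B := -B)
      (by rw [hsum1, card_neg]; omega) hC3 (by rw [hsum1, hAcstab]) hYd'
    rw [hsum1, compl_compl, subsetDist_eq_zero_iff] at h58a
    -- Lemma 5.8 for `(\overline{A+B}, −A)`, sum `B̄`: `d⊆(−A, QAP_{d'}) = 1`
    have hsum2 : (A + B)ᶜ + -A = Bᶜ := by rw [add_comm, h5]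
    obtain ⟨h58b, -, -⟩ := subsetDist_quasiProgression_of_isAP (A := (A + B)ᶜ) (B := -A)
      (by rw [hsum2, card_neg]; omega) hC3 (by rw [hsum2, hBcstab]) hYd'
    have h0 : subsetDist (-A) {P | IsQuasiProgression d' P} = 0 :=
      subsetDist_eq_zero_iff.2 (by rw [Set.mem_setOf_eq, isQuasiProgression_neg_iff]; exact h58a)
    rw [h0] at h58b
    exact zero_ne_one h58b
  -- SECOND, «with the roles of `B` and `\overline{A+B}` interchanged»: `c_d(A+B) ≤ 2` or `B ∈ AP`
  have hsecond : componentCount d (A + B) ≤ 2 ∨ ∃ e, IsAP B e := by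
    by_contra hno
    push Not at hno
    obtain ⟨hcAB3, hBnotAP⟩ := hno
    have hsum : -(A + B)ᶜ + B = -Aᶜ := by rw [← h4, neg_add, neg_neg, add_comm]
    have hUY : #(-(A + B)ᶜ + B) = #(-(A + B)ᶜ) + #B := by rw [hsum, card_neg, card_neg]; omega
    have hc2 : componentCount d (-(A + B)ᶜ + B) = 2 := by
      rw [hsum, componentCount_neg, componentCount_compl, hcA]
    have hc3 : 3 ≤ componentCount d (-(A + B)ᶜ) := by
      rw [componentCount_neg, componentCount_compl]; omega
    have hnp : ¬ IsPeriodic (-(A + B)ᶜ + B + {0, d}) := by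
      rwa [hsum, isPeriodic_neg_add_pair_zero_iff]
    obtain ⟨hcomm, hcrit, hS, -⟩ :=
      critical_add_pair_of_componentCount hCne.neg hBne hUY hc2 hc3 hnp
    have hXcard : #(-(A + B)ᶜ + {0, d}) = #(A + B)ᶜ + componentCount d (A + B) := by
      rw [card_add_pair_zero, componentCount_neg, componentCount_compl, card_neg]
    have hel := isElementaryPair_of_not_isQuasiPeriodic_right (hCne.neg.add ⟨0, mem_insert_self _ _⟩)
      hBne hcrit (by rwa [hcomm]) hBqp hYgenB
    obtain ⟨d', -, hBd'⟩ := exists_isAP_of_isElementaryPair hel (by omega) (by omega)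
      (by rwa [hcomm]) hYgenB (by rw [hS, hsum, card_neg]; omega)
    exact hBnotAP d' hBd'
  rcases hsecond with hcAB | ⟨e, hBe⟩
  · exact Or.inl ⟨hcB, hcAB⟩
  · -- `B` is an arithmetic progression: Lemma 5.8 for `(B, A)` gives (17)
    right
    have hBA : #(B + A) = #B + #A := by rw [add_comm, hAB, add_comm]
    obtain ⟨-, -, β, α, h17⟩ := subsetDist_quasiProgression_of_isAP (A := B) (B := A) hBA hB3
      (by rwa [add_comm]) hBe
    refine ⟨⟨α, β, ?_⟩, Or.inr (subsetDist_eq_zero_iff.2 ⟨e, hBe.ne_zero (by omega), hBe⟩)⟩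
    rw [add_comm (insert α A), h17, add_comm]

end Grynkiewicz2009

end Literature.Combinatorics.Additive
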